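import Mathlib
import Summits.AtomisticToContinuum.HydrodynamicLimit.Theorems.ImplosionDichotomyDenseExcursionPackingAnalyticSonicRayEstimates

/-!
# The weighted contraction step of the holomorphic window problem, and geometric uniform limits
# (crux `DenseExcursion`, stmt-AtomisticToContinuum-12586, line `sonic-cavity-renewal` v9, stub `stub_analyticPackingImplosion`)

Helper file (`--supports stmt-AtomisticToContinuum-12586`, line lead a2, wave-5 worker D2, task `sonicWindow_analytic_bound`,
worker report `work/stubs/D2_triangle.REPORT.md`). EXISTENCE of the holomorphic solution of the order-`k` packing problem on the
sonic triangle is obtained by Picard iteration of the pair map `(P, M) ↦ (T_{a₀}[H(P, M)], transport(P))` in the WEIGHTED sup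
norm `sup e^{−K‖z‖}‖·‖`, `K = L + 4s ≍ Λ` (the weight decreases along the rays from `0`, so it is compatible with the Euler
resolvent and it beats the anti-damping of the transport to the left of the sonic point). Kernel-checked here, abstractly:

* `euler_step_weighted` (REGISTERED helper): a holomorphic solution of `z Y′ + a₀ Y = G` with `‖G‖ ≤ s ε e^{K‖·‖}` obeys
  `‖Y‖ ≤ (s/a₀) ε e^{K‖·‖}` (`eulerHolomorphic_apriori_bound`, monotonicity of the weight along rays);
* `transport_step_weighted` (REGISTERED helper): if `Dm′ = g Dm + F` on a set star-convex w.r.t. `0` with `‖g‖ ≤ L` and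
  `e^{−K‖·‖}‖F‖ ≤ Φ`, `K = L + 4s`, then `e^{−K‖z‖}‖Dm z‖ ≤ ‖Dm 0‖ + Φ/(4s)` (`rayTransport_weighted_bound` from `p = 0`);
* `geometric_uniform_limit`: a sequence of functions with `‖F_{n+1} − F_n‖ ≤ C 2^{−n}` on a set converges uniformly there,
  with the tail bound `‖F_n − F‖ ≤ 2C 2^{−n}`.

Sources: standard (Picard iteration in a weighted norm; Coddington–Levinson 1955 Ch. 1 §3). NOT here: the profile or `Γ`.
-/

noncomputable section

open Set Metric Filter Topology

namespace Summit.AtomisticToContinuum.HydrodynamicLimit.Theorems.PackingAnalyticImplosion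

/-- **THE EULER STEP IN THE WEIGHTED NORM** (registered helper `euler_step_weighted` of `stub_analyticPackingImplosion`):
a holomorphic solution `Y` of `z Y′ + a₀ Y = G` on an open set star-convex w.r.t. `0`, with `‖G w‖ ≤ s ε e^{K‖w‖}` (`K ≥ 0`),
satisfies `‖Y z‖ ≤ (s/a₀) ε e^{K‖z‖}`. [folklore] -/
theorem euler_step_weighted : ∀ (a₀ s K ε : ℝ) (U : Set ℂ) (G Y : ℂ → ℂ), 0 < a₀ → 0 ≤ K → IsOpen U → StarConvex ℝ (0 : ℂ) U → DifferentiableOn ℂ Y U → (∀ w ∈ U, w * deriv Y w + a₀ * Y w = G w) → (∀ w ∈ U, ‖G w‖ ≤ s * ε * Real.exp (K * ‖w‖)) → ∀ z ∈ U, ‖Y z‖ ≤ s / a₀ * ε * Real.exp (K * ‖z‖) := by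
  intro a₀ s K ε U G Y ha₀ hK hU hst hY heq hG z hz
  have h0 : (0 : ℂ) ∈ U := hst.mem ⟨z, hz⟩
  have hsε : 0 ≤ s * ε := by
    have h := hG 0 h0
    rw [norm_zero, mul_zero, Real.exp_zero, mul_one] at h
    exact (norm_nonneg _).trans h
  have hray : ∀ σ ∈ Icc (0 : ℝ) 1, ‖G ((σ : ℂ) * z)‖ ≤ s * ε * Real.exp (K * ‖z‖) := by
    intro σ hσ
    have hmem : (σ : ℂ) * z ∈ U := by
      have h := hst hz (sub_nonneg.2 hσ.2) hσ.1 (sub_add_cancel 1 σ)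
      simpa [Complex.real_smul] using h
    refine (hG _ hmem).trans (mul_le_mul_of_nonneg_left (Real.exp_le_exp.2 ?_) hsε)
    rw [norm_mul, Complex.norm_real, Real.norm_eq_abs, abs_of_nonneg hσ.1]
    exact mul_le_mul_of_nonneg_left (by nlinarith [norm_nonneg z, hσ.2]) hK
  have key := eulerHolomorphic_apriori_bound a₀ U Y G ha₀ hU hst hY heq z hz _ hray
  calc ‖Y z‖ ≤ s * ε * Real.exp (K * ‖z‖) / a₀ := key
    _ = s / a₀ * ε * Real.exp (K * ‖z‖) := by ring

/-- **THE TRANSPORT STEP IN THE WEIGHTED NORM** (registered helper `transport_step_weighted` of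
`stub_analyticPackingImplosion`): if `Dm` has complex derivative `g Dm + F` on a set star-convex w.r.t. `0`, with `‖g‖ ≤ L`
and `e^{−K‖w‖}‖F w‖ ≤ Φ`, `K = L + 4s`, `s > 0`, then `e^{−K‖z‖}‖Dm z‖ ≤ ‖Dm 0‖ + Φ/(4s)` there. [folklore] -/
theorem transport_step_weighted : ∀ (L s K Φ : ℝ) (U : Set ℂ) (g F Dm : ℂ → ℂ), 0 < s → K = L + 4 * s → StarConvex ℝ (0 : ℂ) U → (∀ w ∈ U, ‖g w‖ ≤ L) → (∀ w ∈ U, HasDerivAt Dm (g w * Dm w + F w) w) → (∀ w ∈ U, Real.exp (-(K * ‖w‖)) * ‖F w‖ ≤ Φ) → ∀ z ∈ U, Real.exp (-(K * ‖z‖)) * ‖Dm z‖ ≤ ‖Dm 0‖ + Φ / (4 * s) := by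
  intro L s K Φ U g F Dm hs hKdef hst hg hDm hF z hz
  have h0 : (0 : ℂ) ∈ U := hst.mem ⟨z, hz⟩
  have hΦ : 0 ≤ Φ := by
    have h := hF 0 h0
    rw [norm_zero, mul_zero, neg_zero, Real.exp_zero, one_mul] at h
    exact (norm_nonneg _).trans h
  by_cases hz0 : z = 0
  · subst hz0
    rw [norm_zero, mul_zero, neg_zero, Real.exp_zero, one_mul]
    linarith [div_nonneg hΦ (by linarith : (0 : ℝ) ≤ 4 * s)]
  have hzn : 0 < ‖z‖ := norm_pos_iff.2 hz0
  have hray : ∀ t ∈ Icc (0 : ℝ) 1, (0 : ℂ) + (t : ℂ) * z ∈ U := by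
    intro t ht
    have h := hst hz (sub_nonneg.2 ht.2) ht.1 (sub_add_cancel 1 t)
    simpa [Complex.real_smul] using h
  set β₀ : ℝ := 4 * s * ‖z‖ with hβ₀
  have hβ₀pos : 0 < β₀ := by positivity
  have h1 : ∀ t ∈ Icc (0 : ℝ) 1, HasDerivAt Dm (g (0 + (t : ℂ) * z) * Dm (0 + (t : ℂ) * z) + F (0 + (t : ℂ) * z))
      (0 + (t : ℂ) * z) := fun t ht => hDm _ (hray t ht)
  have h2 : ∀ t ∈ Icc (0 : ℝ) 1, β₀ ≤ K * ‖z‖ + (-(z * g (0 + (t : ℂ) * z))).re := by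
    intro t ht
    have hgn := hg _ (hray t ht)
    have hre : |(-(z * g (0 + (t : ℂ) * z))).re| ≤ ‖z‖ * L := by
      refine (Complex.abs_re_le_norm _).trans ?_
      rw [norm_neg, norm_mul]
      exact mul_le_mul_of_nonneg_left hgn (norm_nonneg z)
    have := (abs_le.1 hre).1
    rw [hKdef, hβ₀]
    nlinarith
  have h3 : ∀ t ∈ Icc (0 : ℝ) 1, Real.exp (-(K * t * ‖z‖)) * ‖F (0 + (t : ℂ) * z)‖ ≤ Φ := by
    intro t ht
    have h := hF _ (hray t ht)
    have hn : ‖(0 : ℂ) + (t : ℂ) * z‖ = t * ‖z‖ := by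
      rw [zero_add, norm_mul, Complex.norm_real, Real.norm_eq_abs, abs_of_nonneg ht.1]
    rw [hn, ← mul_assoc] at h
    exact h
  have key := rayTransport_weighted_bound g F Dm 0 z K β₀ Φ hβ₀pos h1 h2 h3
  rw [zero_add] at key
  have hexp : ‖Dm 0‖ * Real.exp (-β₀) ≤ ‖Dm 0‖ := by
    have : Real.exp (-β₀) ≤ 1 := Real.exp_le_one_iff.2 (by linarith)
    exact (mul_le_mul_of_nonneg_left this (norm_nonneg _)).trans (by rw [mul_one])
  have hlast : ‖z‖ * Φ / β₀ = Φ / (4 * s) := by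
    rw [hβ₀]; field_simp
  linarith [hlast.le, hlast.ge]

/-- **GEOMETRIC UNIFORM LIMITS**: if `‖F_{n+1} w − F_n w‖ ≤ C 2^{−n}` on a set, the sequence converges uniformly there to a
limit `F` with `‖F_n w − F w‖ ≤ 2C 2^{−n}`. [folklore] -/
theorem geometric_uniform_limit (U : Set ℂ) (Fn : ℕ → ℂ → ℂ) (C : ℝ)
    (h : ∀ n, ∀ w ∈ U, ‖Fn (n + 1) w - Fn n w‖ ≤ C * (1 / 2) ^ n) :
    ∃ Flim : ℂ → ℂ, TendstoUniformlyOn Fn Flim atTop U ∧ ∀ n, ∀ w ∈ U, ‖Fn n w - Flim w‖ ≤ 2 * C * (1 / 2) ^ n := by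
  classical
  have hhalf : (1 / 2 : ℝ) < 1 := by norm_num
  have hdist : ∀ w ∈ U, ∀ n, dist (Fn n w) (Fn (n + 1) w) ≤ C * (1 / 2) ^ n := fun w hw n => by
    rw [dist_comm, dist_eq_norm]; exact h n w hw
  have hcauchy : ∀ w ∈ U, CauchySeq fun n => Fn n w := fun w hw =>
    cauchySeq_of_le_geometric (1 / 2) C hhalf (hdist w hw)
  set Flim : ℂ → ℂ := fun w => if hw : w ∈ U then limUnder atTop (fun n => Fn n w) else 0 with hFlim
  have hlim : ∀ w ∈ U, Tendsto (fun n => Fn n w) atTop (𝓝 (Flim w)) := fun w hw => by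
    simp only [hFlim, dif_pos hw]
    exact (hcauchy w hw).tendsto_limUnder
  have htail : ∀ n, ∀ w ∈ U, ‖Fn n w - Flim w‖ ≤ 2 * C * (1 / 2) ^ n := fun n w hw => by
    have h1 := dist_le_of_le_geometric_of_tendsto (1 / 2) C hhalf (hdist w hw) (hlim w hw) n
    rw [dist_eq_norm] at h1
    calc ‖Fn n w - Flim w‖ ≤ C * (1 / 2) ^ n / (1 - 1 / 2) := h1
      _ = 2 * C * (1 / 2) ^ n := by ring
  refine ⟨Flim, Metric.tendstoUniformlyOn_iff.2 fun ε hε => ?_, htail⟩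
  have hC : Tendsto (fun n : ℕ => 2 * C * (1 / 2 : ℝ) ^ n) atTop (𝓝 0) := by
    have := (tendsto_pow_atTop_nhds_zero_of_lt_one (by norm_num : (0 : ℝ) ≤ 1 / 2) hhalf).const_mul (2 * C)
    simpa using this
  have hev := (hC.eventually (gt_mem_nhds hε))
  refine hev.mono fun n hn w hw => ?_
  rw [dist_comm, dist_eq_norm]
  exact (htail n w hw).trans_lt hn

end Summit.AtomisticToContinuum.HydrodynamicLimit.Theorems.PackingAnalyticImplosion

end
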